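import Summits.CriticalPhenomena.CardyFormulaZ2.Theses.CardyBondTriangular
import Literature.Probability.LatticeModels.TriangularIsoradialEmbedding
import Literature.Probability.LatticeModels.TriangularSquareGrid
import Literature.Probability.Percolation.TriangularIsoradialTiling
import Literature.Probability.Percolation.TriangularBoxCrossingProofs
import HarnessLib

/-!
# Route CardyBondTriangular — item `TriIsoradialInstance` (stmt-CriticalPhenomena-4667)

The triangular lattice `𝕋 = triGraph`, drawn by `z x = √3 (triEmbed x − (1 + ζ)/3)` with faces
`HexVertex` at the scaled, shifted triangle centroids and left/right faces `triEdgeFaces`, is a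
member of Grimmett–Manolescu's class `𝒢` whose canonical measure is critical bond percolation on
`𝕋`: `triGraph` is preconnected, and the rhombic embedding `triIsoradialEmbedding` has exactly this
drawing, is isoradial, is a rhombic tiling (the rhombille tiling), has the H21 square-grid
property, has BAP(`π/6`), and its `isoradialPercolation` is
`bondPercolation triGraph (criticalWeightI (π/6))`.

Every conjunct is already a theorem of the tree; this file only assembles them:

* `Literature.Probability.Percolation.triGraph_preconnected` (`TriangularBoxCrossingProofs`);
* `Literature.Probability.LatticeModels.triIsoradialEmbedding`, `triIsoradialEmbedding_z`,
  `triIsoradialEmbedding_isIsoradial`, `triIsoradialEmbedding_hasBoundedAngles`,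
  `triIsoradialEmbedding_isoradialPercolation` (`TriangularIsoradialEmbedding`);
* `Literature.Probability.Percolation.triIsoradialEmbedding_isRhombicTiling`
  (`TriangularIsoradialTiling`);
* `Literature.Probability.LatticeModels.hasSquareGridProperty_triIsoradialEmbedding`
  (`TriangularSquareGrid`).

Reference: G. R. Grimmett, I. Manolescu, *Bond percolation on isoradial graphs: criticality and
universality*, PTRF 159 (2014), §1 (`𝒢` includes the triangular lattice), §2.1–2.2, §4.2.
-/

namespace Summit.CriticalPhenomena.CardyFormulaZ2.Theorems

open Literature.Probability.LatticeModels Literature.Probability.Percolation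

/-- **`𝕋 ∈ 𝒢` in the normalisation of route `CardyBondTriangular`** (item
`TriIsoradialInstance`, stmt-CriticalPhenomena-4667): `triGraph` is preconnected and
`triIsoradialEmbedding` — drawing `z x = √3 (triEmbed x − (1 + ζ)/3)` — is isoradial, a rhombic
tiling, has the square-grid property and BAP(`π/6`), and its canonical measure is
`bondPercolation triGraph (criticalWeightI (π/6))`. Assembled from the tree theorems listed in the
module docstring (Grimmett–Manolescu 2014, §1, §2.1–2.2, §4.2). -/
theorem triIsoradialInstance_proof :
    Summit.CriticalPhenomena.CardyFormulaZ2.Theses.CardyBondTriangular.TriIsoradialInstance := by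
  unfold Summit.CriticalPhenomena.CardyFormulaZ2.Theses.CardyBondTriangular.TriIsoradialInstance
  exact ⟨triGraph_preconnected, triIsoradialEmbedding, triIsoradialEmbedding_z,
    triIsoradialEmbedding_isIsoradial, triIsoradialEmbedding_isRhombicTiling,
    hasSquareGridProperty_triIsoradialEmbedding, triIsoradialEmbedding_hasBoundedAngles,
    triIsoradialEmbedding_isoradialPercolation⟩

end Summit.CriticalPhenomena.CardyFormulaZ2.Theorems
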